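import Mathlib
import Literature.NumberTheory.Transcendental.NesterenkoBricksPadic
import Literature.NumberTheory.Transcendental.TaylorCoeffIntegral
import HarnessLib

/-!
# ζ(5) search — growth side of Lai's box function, part 1: bounded divided derivatives of the bricks
# (fam-indep, κ₃ ladder: the `growth` / `β` input, step 1)

HONEST FRAMING: systematic search; no irrationality claim unless certified.

OUR work (Summit side; cell `pub-zeta5`, family `indep`, planner seat gen 4, STAGED for the lane). This is the
archimedean twin of the tree's `IsDInt` calculus (`Literature.NumberTheory.Transcendental.TaylorCoeffIntegral`):
instead of `D^j · 𝒟ⱼ f(x) ∈ ℤ` we track **`|𝒟ⱼ f(x)| ≤ a · c^j` for all `j ≤ N`** (`IsDBnd N f x a c`), which is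
closed under products with `(a, c) ↦ (a₁a₂, c₁ + c₂)` (Leibniz rule without binomials + `add_pow`), and we compute
admissible `(a, c)` for Nesterenko's bricks at an integer point `−k`:
* an affine factor `q t + e`: `(|q x + e| + |q|, 1)`; a linear factor `t + e` with `x + e ≠ 0`: `(|x + e|, |x + e|⁻¹)`;
  a simple pole `(t + e)⁻¹` with `|x + e| ≥ 1`: `(|x + e|⁻¹, 1)`;
* the polynomial brick `polyBrick b m = (t+b)⋯(t+b+m−1)/m!` at `−k` off its zeros: `(|polyBrick b m (−k)|, m)`;
* the regularised reciprocal brick `recipBrickReg a m k = (m−1)!·(t+k)^{[k ∉ poles]}/∏_{l ≠ k−a}(t+a+l)` at `−k`: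
  `(recipRegAbs a m k, m + 1)` with `recipRegAbs = (m−1)!/∏_{l ≠ k−a}|a+l−k|` (NO hypothesis on `k`).
So every divided derivative of a product of `L` bricks at `−k` is at most (product of the bricks' centre sizes) ×
(total width)^j — polynomial in the width for FIXED order `j`, which is the shape of Lai's growth estimate
[Lai2024BallRivoal, Lemma 5.4 / (5.14)–(5.16)] with Cauchy's integral formula replaced by the Leibniz rule. Part 2
(`LaiGrowthCenter.lean`) applies this to `laiG` and yields `|C_n c_{s−1,k}| ≤ laiGAbs(k) · laiGWidth^{J−s}`.

References: [Lai2024BallRivoal, §5]; [Zudilin2004, §7 Lemma 17 (the logarithmic-derivative recursion)].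
-/

open Finset Filter Literature.NumberTheory.Transcendental Literature.Analysis.Calculus
open scoped Nat Topology

namespace Summit.KontsevichZagierPeriods.Zeta5Search

noncomputable section

/-! ### Bounded divided derivatives -/

/-- `IsDBnd N f x a c`: `f` is `C^N` at `x`, `0 ≤ c`, and `|𝒟ᵢ f(x)| ≤ a · c^i` for every `i ≤ N`. [this file] -/
def IsDBnd (N : ℕ) (f : ℚ → ℚ) (x : ℚ) (a c : ℚ) : Prop :=
  ContDiffAt ℚ N f x ∧ 0 ≤ c ∧ ∀ i ≤ N, |divDeriv i f x| ≤ a * c ^ i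

namespace IsDBnd

variable {N : ℕ} {f g : ℚ → ℚ} {x a c a₁ c₁ a₂ c₂ : ℚ}

/-- Smoothness. [folklore] -/
theorem contDiffAt (h : IsDBnd N f x a c) : ContDiffAt ℚ N f x := h.1

/-- The width constant is non-negative. [folklore] -/
theorem c_nonneg (h : IsDBnd N f x a c) : 0 ≤ c := h.2.1

/-- The bound. [folklore] -/
theorem bound (h : IsDBnd N f x a c) : ∀ i ≤ N, |divDeriv i f x| ≤ a * c ^ i := h.2.2

/-- The size constant is non-negative. [folklore] -/
theorem a_nonneg (h : IsDBnd N f x a c) : 0 ≤ a := by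
  have := h.bound 0 (Nat.zero_le _)
  rw [pow_zero, mul_one] at this
  exact (abs_nonneg _).trans this

/-- Monotonicity in the constants. [folklore] -/
theorem mono (h : IsDBnd N f x a c) {a' c' : ℚ} (ha : a ≤ a') (hc : c ≤ c') : IsDBnd N f x a' c' :=
  ⟨h.contDiffAt, h.c_nonneg.trans hc, fun i hi => (h.bound i hi).trans
    (mul_le_mul ha (pow_le_pow_left₀ h.c_nonneg hc i) (pow_nonneg h.c_nonneg i) (h.a_nonneg.trans ha))⟩

/-- Rewriting the constants. [folklore] -/
theorem of_eq (h : IsDBnd N f x a c) {a' c' : ℚ} (ha : a = a') (hc : c = c') : IsDBnd N f x a' c' := by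
  subst ha hc; exact h

/-- Invariance under local agreement. [folklore] -/
theorem congr (h : IsDBnd N f x a c) (hfg : f =ᶠ[𝓝 x] g) : IsDBnd N g x a c :=
  ⟨h.contDiffAt.congr_of_eventuallyEq hfg.symm, h.c_nonneg, fun i hi => by
    rw [← divDeriv_congr (j := i) hfg]; exact h.bound i hi⟩

/-- **Closure under products**: `(a₁, c₁) · (a₂, c₂) ↦ (a₁ a₂, c₁ + c₂)` (Leibniz rule + `add_pow`). [this file] -/
theorem mul (hf : IsDBnd N f x a₁ c₁) (hg : IsDBnd N g x a₂ c₂) :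
    IsDBnd N (fun t => f t * g t) x (a₁ * a₂) (c₁ + c₂) := by
  refine ⟨hf.contDiffAt.mul hg.contDiffAt, add_nonneg hf.c_nonneg hg.c_nonneg, fun j hj => ?_⟩
  have hfj : ContDiffAt ℚ j f x := hf.contDiffAt.of_le (by exact_mod_cast hj)
  have hgj : ContDiffAt ℚ j g x := hg.contDiffAt.of_le (by exact_mod_cast hj)
  rw [divDeriv_fun_mul hfj hgj]
  calc |∑ i ∈ range (j + 1), divDeriv i f x * divDeriv (j - i) g x|
      ≤ ∑ i ∈ range (j + 1), |divDeriv i f x * divDeriv (j - i) g x| := abs_sum_le_sum_abs _ _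
    _ ≤ ∑ i ∈ range (j + 1), a₁ * c₁ ^ i * (a₂ * c₂ ^ (j - i)) * (j.choose i : ℚ) := by
        refine sum_le_sum fun i hi => ?_
        have hij : i ≤ j := Nat.lt_succ_iff.1 (mem_range.1 hi)
        rw [abs_mul]
        have hprod : |divDeriv i f x| * |divDeriv (j - i) g x| ≤ a₁ * c₁ ^ i * (a₂ * c₂ ^ (j - i)) :=
          mul_le_mul (hf.bound i (hij.trans hj)) (hg.bound (j - i) ((Nat.sub_le j i).trans hj)) (abs_nonneg _)
            (mul_nonneg hf.a_nonneg (pow_nonneg hf.c_nonneg _))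
        have hnn : 0 ≤ a₁ * c₁ ^ i * (a₂ * c₂ ^ (j - i)) :=
          (mul_nonneg (abs_nonneg _) (abs_nonneg _)).trans hprod
        have hch : (1 : ℚ) ≤ (j.choose i : ℚ) := by exact_mod_cast Nat.choose_pos hij
        calc |divDeriv i f x| * |divDeriv (j - i) g x| ≤ a₁ * c₁ ^ i * (a₂ * c₂ ^ (j - i)) * 1 := by
              rw [mul_one]; exact hprod
          _ ≤ _ := mul_le_mul_of_nonneg_left hch hnn
    _ = a₁ * a₂ * (c₁ + c₂) ^ j := by
        rw [add_pow, mul_sum]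
        exact sum_congr rfl fun i _ => by ring

/-- A constant. [folklore] -/
theorem const (N : ℕ) (u x : ℚ) : IsDBnd N (fun _ => u) x |u| 0 := by
  refine ⟨contDiffAt_const, le_rfl, fun j _ => ?_⟩
  rw [divDeriv_const]
  split_ifs with h
  · subst h; simp
  · rw [abs_zero, zero_pow h, mul_zero]

/-- Finite products: `(∏ aᵢ, ∑ cᵢ)`. [this file] -/
theorem prod {ι : Type*} (s : Finset ι) {F : ι → ℚ → ℚ} {A C : ι → ℚ}
    (h : ∀ i ∈ s, IsDBnd N (F i) x (A i) (C i)) :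
    IsDBnd N (fun t => ∏ i ∈ s, F i t) x (∏ i ∈ s, A i) (∑ i ∈ s, C i) := by
  classical
  induction s using Finset.induction_on with
  | empty => simpa using const N 1 x
  | insert a s ha ih =>
    have := (h a (mem_insert_self a s)).mul (ih fun i hi => h i (mem_insert_of_mem hi))
    simpa [prod_insert ha, sum_insert ha] using this

/-- An affine factor `q t + e`: `(|q x + e| + |q|, 1)`. [folklore] -/
theorem affine (N : ℕ) (q e x : ℚ) : IsDBnd N (fun t => q * t + e) x (|q * x + e| + |q|) 1 := by
  refine ⟨(contDiffAt_const.mul contDiffAt_id).add contDiffAt_const, zero_le_one, fun j _ => ?_⟩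
  rw [divDeriv, iteratedDeriv_affine, one_pow, mul_one]
  rcases j with _ | _ | j
  · simp
  · simp
  · rw [if_neg (by omega), if_neg (by omega), zero_div, abs_zero]
    positivity

/-- A linear factor `t + e` at a point with `x + e ≠ 0`: `(|x + e|, |x + e|⁻¹)` (sharp). [folklore] -/
theorem add_const (N : ℕ) {e x : ℚ} (h : x + e ≠ 0) : IsDBnd N (fun t => t + e) x |x + e| |x + e|⁻¹ := by
  refine ⟨contDiffAt_id.add contDiffAt_const, inv_nonneg.2 (abs_nonneg _), fun j _ => ?_⟩
  have := iteratedDeriv_affine 1 e x j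
  simp only [one_mul] at this
  rw [divDeriv, this]
  rcases j with _ | _ | j
  · simp
  · simp [mul_inv_cancel₀ (abs_ne_zero.2 h)]
  · rw [if_neg (by omega), if_neg (by omega), zero_div, abs_zero]
    positivity

/-- A simple pole `(t + e)⁻¹` at distance `≥ 1`: `(|x + e|⁻¹, 1)`. [folklore] -/
theorem inv_add_const (N : ℕ) {e x : ℚ} (h : 1 ≤ |x + e|) : IsDBnd N (fun t => (t + e)⁻¹) x |x + e|⁻¹ 1 := by
  have hne : x + e ≠ 0 := abs_pos.1 (zero_lt_one.trans_le h)
  refine ⟨contDiffAt_inv_add_const hne, zero_le_one, fun j _ => ?_⟩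
  rw [divDeriv_inv_add_const j hne, abs_div, abs_pow, abs_pow, abs_neg, abs_one, one_pow, mul_one, one_div]
  exact inv_anti₀ (abs_pos.2 hne) (le_self_pow₀ h (Nat.succ_ne_zero j))

end IsDBnd

/-! ### The bricks -/

/-- A non-zero integer has absolute value `≥ 1` (in `ℚ`). [folklore] -/
theorem one_le_abs_intCast {z : ℤ} (hz : z ≠ 0) : (1 : ℚ) ≤ |(z : ℚ)| := by
  exact_mod_cast Int.one_le_abs hz

/-- **The polynomial brick** at an integer point off its zeros: `IsDBnd N (polyBrick b m) (−k) |polyBrick b m (−k)| m`.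
[this file] -/
theorem polyBrick_isDBnd (N : ℕ) (b : ℤ) (m : ℕ) (k : ℤ) (hk : ∀ l < m, b + (l : ℤ) ≠ k) :
    IsDBnd N (polyBrick b m) (-(k : ℚ)) |polyBrick b m (-(k : ℚ))| m := by
  have hne : ∀ l ∈ range m, -(k : ℚ) + ((b : ℚ) + l) ≠ 0 := by
    intro l hl h0
    have : ((b + (l : ℤ) - k : ℤ) : ℚ) = 0 := by push_cast; linarith
    exact hk l (mem_range.1 hl) (by linarith [(by exact_mod_cast this : (b + (l : ℤ) - k : ℤ) = 0)])
  have hfac : ∀ l ∈ range m, IsDBnd N (fun t : ℚ => t + ((b : ℚ) + l)) (-(k : ℚ))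
      |-(k : ℚ) + ((b : ℚ) + l)| 1 := fun l hl =>
    (IsDBnd.add_const N (hne l hl)).mono le_rfl (by
      have h1 : (1 : ℚ) ≤ |-(k : ℚ) + ((b : ℚ) + l)| := by
        have := one_le_abs_intCast (z := b + l - k) (fun h0 => hk l (mem_range.1 hl) (by linarith))
        convert this using 2; push_cast; ring
      exact inv_le_one_of_one_le₀ h1)
  have hprod := IsDBnd.prod (range m) hfac
  have hall := hprod.mul (IsDBnd.const N ((m ! : ℚ)⁻¹) (-(k : ℚ)))
  refine (hall.congr (Eventually.of_forall fun t => ?_)).of_eq ?_ ?_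
  · simp only [polyBrick, div_eq_mul_inv]
    exact congrArg (· * _) (prod_congr rfl fun l _ => by ring)
  · rw [polyBrick, abs_div, abs_prod, Nat.abs_cast, abs_inv, Nat.abs_cast, div_eq_mul_inv]
    exact congrArg (· * _) (prod_congr rfl fun l _ => by ring_nf)
  · simp

/-- The centre size of the regularised reciprocal brick at `−k`: `(m−1)! / ∏_{l<m, a+l≠k} |a+l−k|` (for `k` in the
pole range this is `|recipBrickReg a m k (−k)| = C(m−1, k−a)`; otherwise it is the value of the regular cofactor).
[this file] -/
def recipRegAbs (a : ℤ) (m : ℕ) (k : ℤ) : ℚ :=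
  ((m - 1)! : ℚ) * ∏ l ∈ (range m).filter (fun l : ℕ => a + (l : ℤ) ≠ k), |-(k : ℚ) + ((a + (l : ℤ) : ℤ) : ℚ)|⁻¹

/-- `0 ≤ recipRegAbs`. [folklore] -/
theorem recipRegAbs_nonneg (a : ℤ) (m : ℕ) (k : ℤ) : 0 ≤ recipRegAbs a m k :=
  mul_nonneg (Nat.cast_nonneg _) (prod_nonneg fun _ _ => inv_nonneg.2 (abs_nonneg _))

/-- **The regularised reciprocal brick** at `−k` (any integer `k`): `IsDBnd N (recipBrickReg a m k) (−k) (recipRegAbs a m k)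
(m + 1)`. [this file] -/
theorem recipBrickReg_isDBnd (N : ℕ) (a : ℤ) (m : ℕ) (k : ℤ) :
    IsDBnd N (recipBrickReg a m k) (-(k : ℚ)) (recipRegAbs a m k) (m + 1) := by
  set s := (range m).filter (fun l : ℕ => a + (l : ℤ) ≠ k) with hs
  have hfac : ∀ l ∈ s, IsDBnd N (fun t : ℚ => (t + ((a + (l : ℤ) : ℤ) : ℚ))⁻¹) (-(k : ℚ))
      |-(k : ℚ) + ((a + (l : ℤ) : ℤ) : ℚ)|⁻¹ 1 := by
    intro l hl
    have hlk : a + (l : ℤ) ≠ k := (mem_filter.1 hl).2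
    refine IsDBnd.inv_add_const N ?_
    have := one_le_abs_intCast (z := a + l - k) (by omega)
    convert this using 2; push_cast; ring
  have hprod := IsDBnd.prod s hfac
  have hlast : IsDBnd N (fun t : ℚ => if a ≤ k ∧ k < a + m then (1 : ℚ) else t + k) (-(k : ℚ)) 1 1 := by
    by_cases hk : a ≤ k ∧ k < a + m
    · simp only [hk, and_self, ↓reduceIte]
      exact (IsDBnd.const N 1 _).mono (by simp) zero_le_one
    · simp only [hk, ↓reduceIte]
      have h1 := (IsDBnd.affine N 1 (k : ℚ) (-(k : ℚ))).congr (g := fun t => t + (k : ℚ))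
        (Eventually.of_forall fun t => by ring)
      exact h1.of_eq (by simp) rfl
  have hall := ((IsDBnd.const N (((m - 1)! : ℕ) : ℚ) (-(k : ℚ))).mul hprod).mul hlast
  refine ((hall.congr (Eventually.of_forall fun t => ?_)).of_eq ?_ rfl).mono le_rfl ?_
  · simp only [recipBrickReg, hs]
  · simp only [recipRegAbs, hs, Nat.abs_cast, mul_one]
  · rw [zero_add, sum_const, nsmul_eq_mul, mul_one]
    have : (s.card : ℚ) ≤ m := by exact_mod_cast (card_filter_le _ _).trans (card_range m).le
    linarith



end

end Summit.KontsevichZagierPeriods.Zeta5Search
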